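import Summits.CriticalPhenomena.PercolationContinuityZ3.Theorems.FK.BoxClusterCountFree
import Summits.CriticalPhenomena.PercolationContinuityZ3.Theorems.FK.ClusterCountWiredBound
import HarnessLib

/-!
# FK-continuity cell, FO-10a: the WIRED box law has at most `|Λ_N| κ¹ + 2` clusters on average —
# `φ¹_{Λ_N,p,q}(k¹(ω,Λ_N)) ≤ Σ_{x ∈ Λ_N} φ¹_{p,q}(|C_x|⁻¹) + 2` (Grimmett 2006, proof of Thm. (4.58), (4.81)–(4.83), wired side)

Registered R89 (cell INBOX l.6394, 2026-08-24); registry row FO-10a-g338k; label KAP-E (coordinator fk-4 g195).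
Cell `fk-continuity` (bschramm), row FO-10a; support file for the FK-continuity transplant
(`--supports stmt-CriticalPhenomena-4575`); builds on p205010 (kernel theorem, internal audit signed;
external expert review pending). Pure proofs; no definitions, no named facts, no sorries; `d ≥ 1`.

The wired upper bound of the mean number of open clusters of the box law, WITHOUT the ergodic theorem (4.83):
`k¹(ω,Λ) ≤ 1 + Σ_x 1{C^Λ_x ∩ ∂Λ = ∅}·|C^Λ_x|⁻¹` (`ClusterCountWiredBound.lean`); the summand is a combination with
nonnegative coefficients of the indicators of the DECREASING events `{C^Λ_x ∩ ∂Λ = ∅}` and `{C^Λ_x ∩ ∂Λ = ∅, |C^Λ_x| < k}`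
(`ClusterSizeLocality.lean`'s truncation identities), which are determined inside `Λ` and on which `φ¹_Λ ≤ φ¹`
(`IsBoxLimit.rcBoxLaw_real_le_of_isLowerSet`); on lattice configurations a cluster avoiding `∂Λ` cannot leave `Λ`, so
`φ¹` of the lifted events is at most `φ¹(|C_x| < k)`; and `1 − Σ_{k=2}^{|Λ|} φ¹(|C_x| ≥ k)/((k−1)k) ≤ φ¹(|C_x|⁻¹) + 1/|Λ|`.

* `openCluster_inter_edgesIn_subset`, `openCluster_eq_of_disjoint_innerBoundary` — a cluster of `ω ∩ E_Λ` avoiding the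
  inner vertex boundary of `Λ` is the full cluster (lattice configurations);
* `rcBoxMeasure_true_real_disjoint_lt_le` — `φ¹_Λ(C^Λ_x ∩ ∂Λ = ∅, |C^Λ_x| < k) ≤ 1 − φ¹(|C_x| ≥ k)`;
* `rcExpect_ite_inv_ncard_le` — per site: `E¹_Λ[1{C^Λ_x ∩ ∂Λ = ∅}·|C^Λ_x|⁻¹] ≤ φ¹(|C_x|⁻¹) + 1/|Λ_N|`;
* HEADLINE `rcExpect_clusterCount_true_le_sum_integral_inv_ncard_add_two` —
  `E¹_{Λ_N,p,q}[k¹(ω,Λ_N)] ≤ Σ_{x ∈ Λ_N} ∫ |C_x|⁻¹ dφ¹_{p,q} + 2`.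

## References
* G. Grimmett, *The Random-Cluster Model*, Springer 2006 (`book:grimmett2006-random-cluster-model`): §4.5,
  proof of Thm. (4.58), (4.81)–(4.83) [PDF p. 94]. [Grimmett2006]
-/

noncomputable section

open scoped Classical
open Finset Filter Topology MeasureTheory

namespace Summit.CriticalPhenomena.PercolationContinuityZ3.Theorems.FK

open Literature.Probability.Percolation Literature.Probability.LatticeModels

variable {d : ℕ}

/-! ### A cluster avoiding the inner boundary does not leave the region -/

section Boundary

/-- The cluster of `x ∈ Λ` in `ω ∩ E_Λ` stays in `Λ`. [folklore] -/
theorem openCluster_inter_edgesIn_subset {Λ : Finset (Site d)} (ω : BondConfig (Site d)) {x : Site d} (hx : x ∈ Λ) :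
    openCluster (ω ∩ ↑(edgesIn (zdGraph d) Λ)) x ⊆ ↑Λ := by
  intro y hy
  obtain ⟨W⟩ := (hy : (openGraph (ω ∩ ↑(edgesIn (zdGraph d) Λ))).Reachable x y)
  induction W with
  | nil => exact hx
  | @cons a b _ hab _ ih =>
    refine ih ?_ 
    rw [openGraph_adj] at hab
    have h := hab.1.2
    rw [Finset.mem_coe, mem_edgesIn_iff] at h
    exact h.2 b (Sym2.mem_mk_right a b)

/-- **On lattice configurations, a cluster of `ω ∩ E_Λ` avoiding the inner vertex boundary `∂Λ` is the whole cluster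
of `ω`.** [cite: Grimmett2006, proof of Thm. (4.58) (clusters not touching ∂Λ)] -/
theorem openCluster_eq_of_disjoint_innerBoundary {Λ : Finset (Site d)} {ω : BondConfig (Site d)}
    (hω : ω ⊆ (zdGraph d).edgeSet) {x : Site d} (hx : x ∈ Λ)
    (hdisj : Disjoint (openCluster (ω ∩ ↑(edgesIn (zdGraph d) Λ)) x) ↑(innerBoundary (zdGraph d) Λ)) :
    openCluster ω x = openCluster (ω ∩ ↑(edgesIn (zdGraph d) Λ)) x := by
  refine Set.Subset.antisymm ?_ (openCluster_mono Set.inter_subset_left x)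
  intro y hy
  obtain ⟨W⟩ := (hy : (openGraph ω).Reachable x y)
  -- along the walk every vertex stays in the restricted cluster
  suffices h : ∀ (u v : Site d) (_ : (openGraph ω).Walk u v),
      u ∈ openCluster (ω ∩ ↑(edgesIn (zdGraph d) Λ)) x → v ∈ openCluster (ω ∩ ↑(edgesIn (zdGraph d) Λ)) x from
    h x y W (mem_openCluster_self _ x)
  intro u v W
  induction W with
  | nil => exact id
  | @cons a b c hab _ ih =>
    intro ha
    refine ih ?_
    have haΛ : a ∈ Λ := openCluster_inter_edgesIn_subset ω hx ha
    rw [openGraph_adj] at hab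
    have hadj : (zdGraph d).Adj a b := by
      have := hω hab.1
      rwa [SimpleGraph.mem_edgeSet] at this
    by_cases hbΛ : b ∈ Λ
    · -- the edge lies in `E_Λ`, so `b` joins the restricted cluster
      have he : s(a, b) ∈ ω ∩ ↑(edgesIn (zdGraph d) Λ) := by
        refine ⟨hab.1, ?_⟩
        rw [Finset.mem_coe, mem_edgesIn_iff]
        refine ⟨hω hab.1, fun z hz => ?_⟩
        rcases Sym2.mem_iff.1 hz with rfl | rfl
        exacts [haΛ, hbΛ]
      exact (ha : (openGraph _).Reachable x a).trans
        (SimpleGraph.Adj.reachable ((openGraph_adj _ a b).2 ⟨he, hab.2⟩))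
    · -- otherwise `a ∈ ∂Λ` lies in the restricted cluster: contradiction
      exfalso
      refine Set.disjoint_left.1 hdisj ha ?_
      rw [Finset.mem_coe, mem_innerBoundary_iff]
      exact ⟨haΛ, b, hbΛ, hadj⟩

end Boundary

/-! ### Per site: the decreasing level events and their domination -/

section PerSite

variable {p q : ℝ}

/-- **`φ¹_{Λ_N}(C^{Λ_N}_x ∩ ∂Λ_N = ∅, |C^{Λ_N}_x| < k) ≤ 1 − φ¹(|C_x| ≥ k)`** (`x ∈ Λ_N`, `d ≥ 1`): the event is decreasing
and determined inside `Λ_N`, so the wired box law is dominated by the wired limit on it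
(`IsBoxLimit.rcBoxLaw_real_le_of_isLowerSet`), and under the (lattice-carried) limit a cluster avoiding `∂Λ_N` is the
full cluster. [cite: Grimmett2006, Thm. (4.19)(b) proof with (4.81)] -/
theorem rcBoxMeasure_true_real_disjoint_lt_le (hd : 0 < d) (hp : p ∈ Set.Icc (0 : ℝ) 1) (hq : 1 ≤ q) {N : ℕ}
    (x : ↥(box d N)) (k : ℕ) :
    (rcBoxMeasure d true p q N).real
        {ω | Disjoint (openCluster ω x) (boxBC d true N) ∧ ¬ (k : ℕ∞) ≤ (openCluster ω x).encard} ≤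
      1 - (rcLimit d true p q).real (clusterSizeGe (x : Site d) k) := by
  have hq0 : 0 < q := one_pos.trans_le hq
  haveI := isProbabilityMeasure_rcLimit (d := d) true p q
  set E : Set (Sym2 (Site d)) := ↑(edgesIn (zdGraph d) (box d N)) with hE
  set A : Set (BondConfig (Site d)) :=
    {ω | Disjoint (openCluster (ω ∩ E) (x : Site d)) ↑(innerBoundary (zdGraph d) (box d N)) ∧
      ¬ (k : ℕ∞) ≤ (openCluster (ω ∩ E) (x : Site d)).encard} with hA
  -- `A` is decreasing and determined by `E_{Λ_N}`
  have hAl : IsLowerSet A := by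
    intro ω ω' hle hω
    have hsub : openCluster (ω' ∩ E) (x : Site d) ⊆ openCluster (ω ∩ E) (x : Site d) :=
      openCluster_mono (Set.inter_subset_inter_left _ hle) _
    exact ⟨Set.disjoint_of_subset_left hsub hω.1, fun h => hω.2 (h.trans (Set.encard_le_encard hsub))⟩
  have hAdet : DeterminedBy A ↑(edgesIn (zdGraph d) (box d N)) := by
    rw [determinedBy_iff]
    intro ω ω' h
    have h' : ω ∩ E = ω' ∩ E := by rw [hE]; exact h
    simp only [hA, Set.mem_setOf_eq, h']
  have hF : ∀ e ∈ edgesIn (zdGraph d) (box d N), ∀ z ∈ e, z ∈ box d N := fun e he => (mem_edgesIn_iff.1 he).2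
  -- box side: the event is the pull-back of `A`
  have hbox : (rcBoxMeasure d true p q N).real
        {ω | Disjoint (openCluster ω x) (boxBC d true N) ∧ ¬ (k : ℕ∞) ≤ (openCluster ω x).encard} =
      (rcBoxMeasure d true p q N).real (liftEdges (box d N) ⁻¹' A) := by
    rw [rcBoxMeasure, rcMeasure_real_eq_rcExpect _ hp hq0, rcMeasure_real_eq_rcExpect _ hp hq0]
    refine rcExpect_congr _ p q _ fun ω hω => ?_
    have hint : liftEdges (box d N) (↑ω : BondConfig ↥(box d N)) ∩ E = liftEdges (box d N) (↑ω : BondConfig ↥(box d N)) :=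
      Set.inter_eq_left.2 (by simpa using liftEdges_coe_subset_edgesIn hω 0)
    have key : ((↑ω : BondConfig ↥(box d N)) ∈
        {ω : BondConfig ↥(box d N) | Disjoint (openCluster ω x) (boxBC d true N) ∧ ¬ (k : ℕ∞) ≤ (openCluster ω x).encard}) ↔
        liftEdges (box d N) (↑ω : BondConfig ↥(box d N)) ∈ A := by
      rw [hA, Set.mem_setOf_eq, Set.mem_setOf_eq, hint, encard_openCluster_liftEdges, openCluster_liftEdges_eq_image]
      refine and_congr_left fun _ => ?_
      constructor
      · intro h
        refine Set.disjoint_left.2 ?_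
        rintro _ ⟨y, hy, rfl⟩ hyB
        refine Set.disjoint_left.1 h hy ?_
        simpa [boxBC] using hyB
      · intro h
        refine Set.disjoint_left.2 fun y hy hyB => ?_
        refine Set.disjoint_left.1 h (Set.mem_image_of_mem _ hy) ?_
        simpa [boxBC] using hyB
    simp only [Set.mem_preimage, key]
  rw [hbox, ← rcBoxLaw_real_apply true p q N (hAdet.measurableSet_of_finset)]
  refine ((isBoxLimit_rcLimit true hp hq).rcBoxLaw_real_le_of_isLowerSet hd hp hq hAdet hAl hF).trans ?_
  -- limit side: on lattice configurations in `A` the full cluster has fewer than `k` vertices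
  have hmeas : MeasurableSet (clusterSizeGe (x : Site d) k) := measurableSet_clusterSizeGe _ _
  rw [← probReal_compl_eq_one_sub hmeas]
  simp only [measureReal_def]
  refine ENNReal.toReal_mono (measure_ne_top _ _) (measure_mono_ae ?_)
  filter_upwards [(isBoxLimit_rcLimit true hp hq).ae_subset_edgeSet hp hq0] with ω hω
  intro hωA
  show ω ∈ (clusterSizeGe (x : Site d) k)ᶜ
  rw [Set.mem_compl_iff, mem_clusterSizeGe, openCluster_eq_of_disjoint_innerBoundary hω x.2 hωA.1]
  exact hωA.2

/-- On the box graph: `1{C^Λ_x ∩ ∂Λ = ∅}·|C^Λ_x|⁻¹ = 1{C ∩ ∂Λ = ∅}/|Λ| + Σ_{k=2}^{|Λ|} 1{C ∩ ∂Λ = ∅, |C| < k}/((k−1)k)` —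
a nonnegative combination of indicators of decreasing events. [cite: Grimmett2006, proof of Thm. (4.58)] -/
theorem ite_inv_ncard_openCluster_eq_sum {N : ℕ} (ω : BondConfig ↥(box d N)) (x : ↥(box d N)) (B : Set ↥(box d N)) :
    (if Disjoint (openCluster ω x) B then (((openCluster ω x).ncard : ℝ))⁻¹ else 0) =
      (if Disjoint (openCluster ω x) B then (1 : ℝ) / Fintype.card ↥(box d N) else 0) +
        ∑ k ∈ Finset.Icc 2 (Fintype.card ↥(box d N)),
          (if Disjoint (openCluster ω x) B ∧ ¬ (k : ℕ∞) ≤ (openCluster ω x).encard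
            then (1 : ℝ) / (((k : ℝ) - 1) * k) else 0) := by
  have hM : 1 ≤ Fintype.card ↥(box d N) := Fintype.card_pos_iff.2 ⟨x⟩
  by_cases hdisj : Disjoint (openCluster ω x) B
  · simp only [hdisj, if_true, true_and]
    rw [inv_ncard_openCluster_eq_one_sub_sum ω x]
    have hsplit : ∀ k ∈ Finset.Icc 2 (Fintype.card ↥(box d N)),
        (if ¬ (k : ℕ∞) ≤ (openCluster ω x).encard then (1 : ℝ) / (((k : ℝ) - 1) * k) else 0) =
          1 / (((k : ℝ) - 1) * k) - (if ω ∈ clusterSizeGe x k then (1 : ℝ) / (((k : ℝ) - 1) * k) else 0) := by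
      intro k _
      rw [mem_clusterSizeGe]
      by_cases h : (k : ℕ∞) ≤ (openCluster ω x).encard
      · simp [h]
      · simp [h]
    rw [Finset.sum_congr rfl hsplit, Finset.sum_sub_distrib, sum_Icc_inv_mul_eq _ hM]
    ring
  · simp only [hdisj, if_false, false_and, Finset.sum_const_zero, add_zero]

/-- **Per site: `E¹_{Λ_N}[1{C^{Λ_N}_x ∩ ∂Λ_N = ∅}·|C^{Λ_N}_x|⁻¹] ≤ φ¹_{p,q}(|C_x|⁻¹) + 1/|Λ_N|`** (`x ∈ Λ_N`, `d ≥ 1`).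
[cite: Grimmett2006, proof of Thm. (4.58), (4.81)–(4.83)] -/
theorem rcExpect_ite_inv_ncard_le (hd : 0 < d) (hp : p ∈ Set.Icc (0 : ℝ) 1) (hq : 1 ≤ q) {N : ℕ} (x : ↥(box d N)) :
    rcExpect (finsetGraph (zdGraph d) (box d N)) p q (boxBC d true N)
        (fun ω => if Disjoint (openCluster (↑ω : BondConfig ↥(box d N)) x) (boxBC d true N)
          then (((openCluster (↑ω : BondConfig ↥(box d N)) x).ncard : ℝ))⁻¹ else 0) ≤
      ∫ ω, ((openCluster ω (x : Site d)).ncard : ℝ)⁻¹ ∂(rcLimit d true p q) + 1 / Fintype.card ↥(box d N) := by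
  have hq0 : 0 < q := one_pos.trans_le hq
  haveI := isProbabilityMeasure_rcLimit (d := d) true p q
  set M := Fintype.card ↥(box d N) with hM
  have hM1 : 1 ≤ M := Fintype.card_pos_iff.2 ⟨x⟩
  have hM0 : (0 : ℝ) < M := by exact_mod_cast hM1
  -- expand the integrand
  have hfun : (fun ω : Finset (Sym2 ↥(box d N)) =>
      if Disjoint (openCluster (↑ω : BondConfig ↥(box d N)) x) (boxBC d true N)
        then (((openCluster (↑ω : BondConfig ↥(box d N)) x).ncard : ℝ))⁻¹ else 0) =
      fun ω : Finset (Sym2 ↥(box d N)) =>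
        (1 / (M : ℝ)) * (if (↑ω : BondConfig ↥(box d N)) ∈
            {ω : BondConfig ↥(box d N) | Disjoint (openCluster ω x) (boxBC d true N)} then (1 : ℝ) else 0) +
        ∑ k ∈ Finset.Icc 2 M, (1 / (((k : ℝ) - 1) * k)) *
          (if (↑ω : BondConfig ↥(box d N)) ∈ {ω : BondConfig ↥(box d N) |
              Disjoint (openCluster ω x) (boxBC d true N) ∧ ¬ (k : ℕ∞) ≤ (openCluster ω x).encard}
            then (1 : ℝ) else 0) := by
    funext ω
    rw [ite_inv_ncard_openCluster_eq_sum, ← hM]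
    simp only [Set.mem_setOf_eq, mul_ite, mul_one, mul_zero]
  rw [hfun, rcExpect_add, rcExpect_const_mul, rcExpect_finset_sum]
  haveI := isProbabilityMeasure_rcMeasure (finsetGraph (zdGraph d) (box d N)) hp hq0 (boxBC d true N)
  -- the first term: a probability is at most one
  have h0 : (1 / (M : ℝ)) * rcExpect (finsetGraph (zdGraph d) (box d N)) p q (boxBC d true N)
      (fun ω => if (↑ω : BondConfig ↥(box d N)) ∈
        {ω : BondConfig ↥(box d N) | Disjoint (openCluster ω x) (boxBC d true N)} then (1 : ℝ) else 0) ≤ 1 / M := by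
    rw [← rcMeasure_real_eq_rcExpect _ hp hq0]
    exact mul_le_of_le_one_right (by positivity) measureReal_le_one
  -- the level terms
  have hk : ∀ k ∈ Finset.Icc 2 M,
      rcExpect (finsetGraph (zdGraph d) (box d N)) p q (boxBC d true N) (fun ω => (1 / (((k : ℝ) - 1) * k)) *
        (if (↑ω : BondConfig ↥(box d N)) ∈ {ω : BondConfig ↥(box d N) |
            Disjoint (openCluster ω x) (boxBC d true N) ∧ ¬ (k : ℕ∞) ≤ (openCluster ω x).encard} then (1 : ℝ) else 0)) ≤
        (1 / (((k : ℝ) - 1) * k)) * (1 - (rcLimit d true p q).real (clusterSizeGe (x : Site d) k)) := by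
    intro k hk
    have hk2 : (2 : ℝ) ≤ k := by exact_mod_cast (Finset.mem_Icc.1 hk).1
    rw [rcExpect_const_mul, ← rcMeasure_real_eq_rcExpect _ hp hq0]
    exact mul_le_mul_of_nonneg_left (rcBoxMeasure_true_real_disjoint_lt_le hd hp hq x k)
      (div_nonneg zero_le_one (by nlinarith))
  -- the infinite-volume side
  have hlim := abs_integral_inv_ncard_sub_le (rcLimit d true p q) (x : Site d) M hM1
  have h1 : 1 - ∑ k ∈ Finset.Icc 2 M, (rcLimit d true p q).real (clusterSizeGe (x : Site d) k) / (((k : ℝ) - 1) * k) ≤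
      ∫ ω, ((openCluster ω (x : Site d)).ncard : ℝ)⁻¹ ∂(rcLimit d true p q) + 1 / M := by
    have := (abs_le.1 hlim).1
    linarith
  have hsumc := sum_Icc_inv_mul_eq M hM1
  calc _ ≤ 1 / (M : ℝ) + ∑ k ∈ Finset.Icc 2 M, (1 / (((k : ℝ) - 1) * k)) *
          (1 - (rcLimit d true p q).real (clusterSizeGe (x : Site d) k)) := add_le_add h0 (Finset.sum_le_sum hk)
    _ = 1 / (M : ℝ) + (∑ k ∈ Finset.Icc 2 M, (1 : ℝ) / (((k : ℝ) - 1) * k)) -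
          ∑ k ∈ Finset.Icc 2 M, (rcLimit d true p q).real (clusterSizeGe (x : Site d) k) / (((k : ℝ) - 1) * k) := by
        rw [add_sub_assoc, ← Finset.sum_sub_distrib]
        congr 1
        refine Finset.sum_congr rfl fun k _ => ?_
        ring
    _ = 1 - ∑ k ∈ Finset.Icc 2 M, (rcLimit d true p q).real (clusterSizeGe (x : Site d) k) / (((k : ℝ) - 1) * k) := by
        rw [hsumc]; ring
    _ ≤ _ := h1

end PerSite

/-! ### The sum over the box -/

section Sum

variable {p q : ℝ}

/-- **`E¹_{Λ_N,p,q}[k¹(ω,Λ_N)] ≤ Σ_{x ∈ Λ_N} φ¹_{p,q}(|C_x|⁻¹) + 2`** (`d ≥ 1`): the mean number of open clusters of the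
wired box law is at most the sum of the infinite-volume wired cluster densities over the box, plus two.
[cite: Grimmett2006, proof of Thm. (4.58), (4.81)–(4.83) (wired side, without the ergodic theorem)] -/
theorem rcExpect_clusterCount_true_le_sum_integral_inv_ncard_add_two (hd : 0 < d) (hp : p ∈ Set.Icc (0 : ℝ) 1)
    (hq : 1 ≤ q) (N : ℕ) :
    rcExpect (finsetGraph (zdGraph d) (box d N)) p q (boxBC d true N)
        (fun ω => (clusterCount (↑ω : BondConfig ↥(box d N)) (boxBC d true N) : ℝ)) ≤
      ∑ x : ↥(box d N), ∫ ω, ((openCluster ω (x : Site d)).ncard : ℝ)⁻¹ ∂(rcLimit d true p q) + 2 := by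
  have hq0 : 0 < q := one_pos.trans_le hq
  set M := Fintype.card ↥(box d N) with hM
  have hM0 : (0 : ℝ) < M := by
    have : 0 < M := Fintype.card_pos_iff.2 ⟨⟨0, zero_mem_box d N⟩⟩
    exact_mod_cast this
  -- the combinatorial bound, in expectation
  have h1 : rcExpect (finsetGraph (zdGraph d) (box d N)) p q (boxBC d true N)
        (fun ω => (clusterCount (↑ω : BondConfig ↥(box d N)) (boxBC d true N) : ℝ)) ≤
      rcExpect (finsetGraph (zdGraph d) (box d N)) p q (boxBC d true N)
        (fun ω => (1 : ℝ) + ∑ x : ↥(box d N),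
          (if Disjoint (openCluster (↑ω : BondConfig ↥(box d N)) x) (boxBC d true N)
            then (((openCluster (↑ω : BondConfig ↥(box d N)) x).ncard : ℝ))⁻¹ else 0)) :=
    rcExpect_mono _ hp hq0 _ fun ω _ => clusterCount_le_one_add_sum_ite_inv_ncard _ _
  refine h1.trans ?_
  rw [rcExpect_add, rcExpect_const _ hp hq0, rcExpect_finset_sum]
  have h2 := Finset.sum_le_sum fun x (_ : x ∈ (Finset.univ : Finset ↥(box d N))) =>
    rcExpect_ite_inv_ncard_le hd hp hq x (N := N)
  rw [Finset.sum_add_distrib, Finset.sum_const, Finset.card_univ, nsmul_eq_mul, ← hM,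
    mul_one_div, div_self hM0.ne'] at h2
  linarith

end Sum

end Summit.CriticalPhenomena.PercolationContinuityZ3.Theorems.FK

end
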